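import Summits.AtomisticToContinuum.Crystallization.Theorems.ChartedZeroExcessLayeredLatticeLiouvilleTD

/-!
# Zero-excess layered lattice Liouville — part TE (lens-2 g33, node «GraphVsLevels» beneath (A0) of part TB): the global chart registration
(A0) `GlobalChartRegistrationP` CUT into its EXISTENCE half (A0♭) `EquilChartGraphP` (an equilibrium layered chart globally graph-isomorphic to the
configuration and `√η`-pinned at scale `R` — a CONSEQUENCE of (A0), PROVED) and its ESTIMATE half (A0♯) `GraphLevelsP` (the registration levels
`Cg·(D/R)·η` at every scale for THAT chart: slaving + drift), with the glue `globalChartRegistrationP_of_graph_levels` PROVED and the columns `_16XH8`,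
`_16XH8W` (17 leaves).  Why the cut is forced (the mismatched-letter budget computation), the word-transplant mechanism behind (A0♭) and the triage of
critic row 557 (B)(4) are in the pieces' docstrings and in the node memo `NODE-g33-GraphVsLevels.md`.
0 EQUIV; placeholder-free; no type-class declarations, custom syntax or option pragmas.
-/

noncomputable section

open scoped BigOperators InnerProductSpace RealInnerProductSpace
open MeasureTheory Set Metric Filter Topology
open Summit.AtomisticToContinuum.Crystallization.Theorems.ChartedPlanarOrderRigidityDoor
  (E3 IsClean IsNash IsCharted IsEStarGSC VisibleGap PertRegime atomsIn siteEnergy eStar BindingSurface)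
open Summit.AtomisticToContinuum.Crystallization.Theorems.ChartedPlanarOrderDensityDichotomy (μS IsSep nK nK_nonneg excess)
open Summit.AtomisticToContinuum.Crystallization.Theorems.ChartedPlanarOrderMesoCut (IsDoorSet NearHom LayeredHom EnvClose)
open Summit.AtomisticToContinuum.Crystallization.Theorems.OverbindingBudgetLiouvilleDictionary (NearHomBD)
open Summit.AtomisticToContinuum.Crystallization.Theorems.ChartedPlanarOrderDoorLayered
  (TwoPeriodic DoorPeriodic PeriodicBulkGapDoor gap_and_pert_1_50_of_periodic NearHomL2BD nearHomL2BD_mono nearHomBD_of_nearHomL2BD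
   sq_le_finsum_mem not_nearHomL2BD_singleton envClose_mono Layered layeredHom_eq_layered atomsIn_subset)
open Summit.AtomisticToContinuum.Crystallization.Theorems.ChartedPlanarOrderDoorLayeredOsc (IsTwoShellAffineGood DoorPeriodicOsc)
open Summit.AtomisticToContinuum.Crystallization.Theorems.ChartedPlanarOrderCleanScaleP
  (IsCleanP IsDoorSetP DoorPeriodicP isDoorSetP_mono doorPeriodic_of_doorPeriodicP isDoorSetP_one_iff doorPeriodicP_one_iff)
open Summit.AtomisticToContinuum.Crystallization.Theorems.ChartedPlanarOrderProfileSlavingLJ (pairForce)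
open Literature.MathematicalPhysics.StatisticalMechanics (haggLabel barlowOffset layerNormal IsHaggSeq triangularVec₁ triangularVec₂)

namespace Summit.AtomisticToContinuum.Crystallization.Theorems.ChartedZeroExcessLayeredLatticeLiouville

/-! ## §VIII  (lens-2 g33, node «GraphVsLevels» beneath (A0)): the global chart registration CUT into its EXISTENCE half (A0♭) and its ESTIMATE
half (A0♯) — `globalChartRegistrationP_of_graph_levels` (PROVED), the consequence direction (A0) ⇒ (A0♭) (PROVED), column `_16XH8` (17 leaves) -/

/-- ★★ **(A0♭) «EquilChartGraphP aHi Λ θ s»** — THE EXISTENCE HALF of (A0) (door `IsDoorSetP`, GSC-free): for every `δ, a` there is `C♭ ≥ 1` (ceiling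
`η₁`, floor `R₁`) such that a θ-good door set that is `η`-registered-flat to equilibrium charts at EVERY scale `D ≥ R` admits ONE equilibrium layered chart
`H = LayeredHom L w` (`IsEquilChart a s Λ L w`: conformal slice, clean, single-site Nash) which (i) still registers the window `win R` at level `C♭·η`
(part Q `IsRegistered`, radius `4`, scale `R`) — so `L` is `√η`-pinned to the configuration at scale `R` — and (ii) is GLOBALLY GRAPH-ISOMORPHIC to `S`: a
bijection `Ψ₀ : S → H` two-sided tear-free at `4 ↦ 8`.  No level is asked of `Ψ₀` and none beyond scale `R` of anything: this is the statement that an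
equilibrium chart carrying `S`'s OWN GLOBAL Hägg word exists near the scale-`R` chart — the existence content hidden in (A0) (a mismatched letter on a layer
costs `≥ 1/3` per site, affordable under `IsGlobalReg`'s profile `Cg·(D/R)·η` only at heights `≳ R/(Cg·η)`, so (A0)'s chart must carry the whole word; the
hypothesis charts carry it only on slabs `|z| ≲ 0.05/η`, and `Cg` is fixed before `R`).  A CONSEQUENCE of (A0) (`equilChartGraphP_of_globalChartRegistrationP`,
PROVED).  EXISTENCE-type · UNDECIDED · TRUE-type-expected · INSTRUMENTABLE.
Mechanism (memo NODE-g33 §3, «word transplant»): rotating the half-stack above a layer by `π` about the layer normal through one of its sites is an exact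
symmetry of that layer (every planar lattice is centrosymmetric), maps `LayeredHom L w` to `LayeredHom L w″` and flips every Hägg letter above; the only
non-invariant energy is the registry-dependent part of the interaction of layers `≥ 2` apart, of relative size `e^{−|G|·2h} ≈ 7·10⁻⁶` (Poisson summation),
so equilibrium offsets for ANY word follow from those of one word by a layer-chain implicit-function argument — in the INTERIOR of the existence region.
Why it might fail: at the boundary of the region (in the `(a, L)`-slice) where homogeneous layered equilibria are single-site Nash, existence depends on the
word at the `10⁻⁵` level; a door set whose scale-`R` chart sits there while its far word needs the other side defeats every `C♭` unless `η₁(a)` excludes it.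
Sources: [this tree: `IsCharted`, `IsEquilChart`, `IsRegistered`, `homStacking_eq_layeredHom`, `pairForce_rotPi`], [EMing2006 §2 (multilattice equilibria,
inner displacements)], [ConwaySloane1999 Ch. 1 §1.3 (Barlow words)], [census TAG 174 (a) core tube; instrument WORD-TRANSPLANT requested]. [this file, g33] -/
def EquilChartGraphP (aHi Λ θ s : ℝ) : Prop :=
  ∀ δ : ℝ, 0 < δ → ∀ a : ℝ, 0 < a → ∃ Cb : ℝ, 1 ≤ Cb ∧ ∃ η₁ : ℝ, 0 < η₁ ∧ ∃ R₁ : ℝ, 0 < R₁ ∧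
    ∀ S : Set E3, IsDoorSetP aHi δ S → (∀ q ∈ S, IsTwoShellAffineGood θ S q) →
      ∀ η : ℝ, 0 < η → η ≤ η₁ → ∀ R : ℝ, R₁ ≤ R →
        (∀ D : ℝ, R ≤ D → NearHomH1BDE a s Λ η 4 D S (atomsIn (μS S) 0 D)) →
          ∃ (L : E3 ≃L[ℝ] E3) (w : ℤ → E3), IsEquilChart a s Λ L w ∧
            (∃ (Ψ : E3 → E3) (τ : E3 → ℝ), IsRegistered (Cb * η) 4 R S (atomsIn (μS S) 0 R) (LayeredHom (L : E3 →L[ℝ] E3) w) Ψ τ) ∧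
            ∃ Ψ₀ : E3 → E3, Set.BijOn Ψ₀ S (LayeredHom (L : E3 →L[ℝ] E3) w) ∧
              (∀ x ∈ S, ∀ p ∈ S, dist p x ≤ 4 → dist (Ψ₀ p) (Ψ₀ x) ≤ 8) ∧ (∀ x ∈ S, ∀ p ∈ S, dist (Ψ₀ p) (Ψ₀ x) ≤ 4 → dist p x ≤ 8)

/-- ★★ **(A0♯) «GraphLevelsP aHi Λ θ s»** — THE ESTIMATE HALF of (A0) (door `IsDoorSetP`, GSC-free): for every `δ, a, C♭` there is `Cg ≥ 1` (ceiling, floor)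
such that: GIVEN an equilibrium chart `H = LayeredHom L w` that registers `win R` at level `C♭·η` and is globally graph-isomorphic to the θ-good,
multi-scale `η`-registered door set `S` (exactly the output of (A0♭)), some registration `Ψ : S → H` (re-chosen: `Ψ₀` composed with a symmetry of `H` may be
needed) is a GLOBAL registration of part TB (`IsGlobalReg Cg η R`: bijective, two-sided tear-free, level `Cg·(D/R)·η` at every scale `D ≥ R`) to THAT chart.
Content: (i) SLAVING — `S` is itself Nash with the same word, so its layer offsets are `√η`-slaved to the homogeneous equilibrium offsets `w` (a forced
layer-chain rigidity statement; lens-3 `SlavingKernelL1` (PROVED) / `TubeMonotone` machinery); (ii) DRIFT — affine-fit rigidity across consecutive scales gives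
`|L_D − L_{2D}| ≤ C√η`, whence `Σ_{win D} τ² ≤ C(1 + log²(D/R))·η·nK ≤ Cg·(D/R)·η·nK`; (iii) graph bookkeeping.  No existence claim.  SLAVING/ESTIMATE-type ·
TRUE-type · ATTACKABLE·M–L.
Why it might fail: non-uniqueness of homogeneous equilibrium offsets for a fixed word and fixed `L` (two relaxed branches) would let the given chart sit on a
branch other than the one `S` follows; the slaving constant must be uniform in the word.
Sources: [this tree: `RegistrationP` (part Q), `SlavingKernelL1`, `TubeMonotone`, `nash_force_balance`], [kruzik2019 p.55 Thm 1.1.12 (FJM rigidity)],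
[Theil2006 §3], [EMing2006 §2]. [this file, g33] -/
def GraphLevelsP (aHi Λ θ s : ℝ) : Prop :=
  ∀ δ : ℝ, 0 < δ → ∀ a : ℝ, 0 < a → ∀ Cb : ℝ, 1 ≤ Cb → ∃ Cg : ℝ, 1 ≤ Cg ∧ ∃ η₁ : ℝ, 0 < η₁ ∧ ∃ R₁ : ℝ, 0 < R₁ ∧
    ∀ S : Set E3, IsDoorSetP aHi δ S → (∀ q ∈ S, IsTwoShellAffineGood θ S q) →
      ∀ η : ℝ, 0 < η → η ≤ η₁ → ∀ R : ℝ, R₁ ≤ R →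
        (∀ D : ℝ, R ≤ D → NearHomH1BDE a s Λ η 4 D S (atomsIn (μS S) 0 D)) →
          ∀ (L : E3 ≃L[ℝ] E3) (w : ℤ → E3), IsEquilChart a s Λ L w →
            (∃ (Ψ : E3 → E3) (τ : E3 → ℝ), IsRegistered (Cb * η) 4 R S (atomsIn (μS S) 0 R) (LayeredHom (L : E3 →L[ℝ] E3) w) Ψ τ) →
              (∃ Ψ₀ : E3 → E3, Set.BijOn Ψ₀ S (LayeredHom (L : E3 →L[ℝ] E3) w) ∧
                (∀ x ∈ S, ∀ p ∈ S, dist p x ≤ 4 → dist (Ψ₀ p) (Ψ₀ x) ≤ 8) ∧ (∀ x ∈ S, ∀ p ∈ S, dist (Ψ₀ p) (Ψ₀ x) ≤ 4 → dist p x ≤ 8)) →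
                ∃ Ψ : E3 → E3, IsGlobalReg Cg η R S (LayeredHom (L : E3 →L[ℝ] E3) w) Ψ

/-- ★★ **(A0) ⟸ (A0♭) ∧ (A0♯) (PROVED)** — the node's glue: ceiling `min`, floor `max`, the chart of (A0♭) handed to (A0♯). [this file, g33] -/
theorem globalChartRegistrationP_of_graph_levels {aHi Λ θ s : ℝ} (hb : EquilChartGraphP aHi Λ θ s) (hl : GraphLevelsP aHi Λ θ s) :
    GlobalChartRegistrationP aHi Λ θ s := by
  intro δ hδ a ha
  obtain ⟨Cb, hCb, η₁, hη₁, R₁, hR₁, Hb⟩ := hb δ hδ a ha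
  obtain ⟨Cg, hCg, η₂, hη₂, R₂, hR₂, Hl⟩ := hl δ hδ a ha Cb hCb
  refine ⟨Cg, hCg, min η₁ η₂, lt_min hη₁ hη₂, max R₁ R₂, lt_max_of_lt_left hR₁, ?_⟩
  intro S hS hgood η hη hηle R hR hms
  obtain ⟨L, w, hLw, hreg, hΨ₀⟩ :=
    Hb S hS hgood η hη (hηle.trans (min_le_left _ _)) R ((le_max_left _ _).trans hR) hms
  obtain ⟨Ψ, hΨ⟩ :=
    Hl S hS hgood η hη (hηle.trans (min_le_right _ _)) R ((le_max_right _ _).trans hR) hms L w hLw hreg hΨ₀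
  exact ⟨L, w, hLw, Ψ, hΨ⟩

/-- ★ **(A0) ⇒ (A0♭) (PROVED)**: the existence half is a CONSEQUENCE of (A0) (take (A0)'s chart and registration; at `D = R` the profile
`Cg·(R/R)·η` is `Cg·η`) — so (A0♭) is weaker than (A0), and strictly so unless (A0♯) is free. [this file, g33] -/
theorem equilChartGraphP_of_globalChartRegistrationP {aHi Λ θ s : ℝ} (h : GlobalChartRegistrationP aHi Λ θ s) : EquilChartGraphP aHi Λ θ s := by
  intro δ hδ a ha
  obtain ⟨Cg, hCg, η₁, hη₁, R₁, hR₁, H⟩ := h δ hδ a ha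
  refine ⟨Cg, hCg, η₁, hη₁, R₁, hR₁, fun S hS hgood η hη hηle R hR hms => ?_⟩
  obtain ⟨L, w, hLw, Ψ, hbij, ht1, ht2, hlev⟩ := H S hS hgood η hη hηle R hR hms
  obtain ⟨τ, hτ⟩ := hlev R le_rfl
  have hR0 : R ≠ 0 := (hR₁.trans_le hR).ne'
  refine ⟨L, w, hLw, ⟨Ψ, τ, ?_⟩, Ψ, hbij, ht1, ht2⟩
  simpa only [div_self hR0, mul_one] using hτ

/-- ★ **(A0♯) ∧ (A0) ⇒ nothing new; (A0♭) ∧ (A0♯) ⇔-free**: recorded only as the column.  ★★★ **COLUMN `_16XH8` — SEVENTEEN opaque leaves**: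
`LatticeLiouvilleCert → LayeredLiouvilleCert → R_G → X → Z_E → P → T → U♮ → A0♭ → A0♯ → FF → E → A⁰ → D⁰ → C♭ → R_W → PeriodicBulkGapDoor 2 →
VisibleGap (1/50) ∧ PertRegime (1/50)` (all at `(aHi; Λ, θ, s) = (1; 2, 1/16, 1/50)`).  Residual of record unchanged: (R_W) alone. [this file, g33] -/
theorem gap_and_pert_1_50_of_certs_16XH8 (hL : LatticeLiouvilleCert) (hL' : LayeredLiouvilleCert)
    (hR : OscRigidityL2BDPG 1 2 (1 / 16) (1 / 16)) (hX : ExcessFlatnessControlP 1 2 (1 / 16) (1 / 16))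
    (hE : ExcessChartLocalisationP 1 2 (1 / 16) (1 / 50)) (hP : RegistrationP 1 2 (1 / 16) (1 / 50))
    (hT : TailDominationCert) (hU : UniformTameStability (1 / 50) 2)
    (hb : EquilChartGraphP 1 2 (1 / 16) (1 / 50)) (hl : GraphLevelsP 1 2 (1 / 16) (1 / 50))
    (hF : TailForceSlavingP 1 2 (1 / 16) (1 / 50))
    (hE' : LipDualLinearisationP 1 2 (1 / 16) (1 / 50)) (hA : L2HarmonicApproxP 1 2 (1 / 16) (1 / 50))
    (hD : PositionDecayPL 1 2 (1 / 16) (1 / 50)) (hC : PositionCaccioppoliPG 1 2 (1 / 16) (1 / 50))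
    (hW : WildFractionPG 1 2 (1 / 16) (1 / 50)) (hG : PeriodicBulkGapDoor 2) : VisibleGap (1 / 50) ∧ PertRegime (1 / 50) :=
  gap_and_pert_1_50_of_certs_16XH7 hL hL' hR hX hE hP hT hU (globalChartRegistrationP_of_graph_levels hb hl) hF hE' hA hD hC hW hG

/-- ★ **COLUMN `_16XH8W`** — the same with (A1) «WildReRegistrationPG» in place of (R_W). [this file, g33] -/
theorem gap_and_pert_1_50_of_certs_16XH8W (hL : LatticeLiouvilleCert) (hL' : LayeredLiouvilleCert)
    (hR : OscRigidityL2BDPG 1 2 (1 / 16) (1 / 16)) (hX : ExcessFlatnessControlP 1 2 (1 / 16) (1 / 16))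
    (hE : ExcessChartLocalisationP 1 2 (1 / 16) (1 / 50)) (hP : RegistrationP 1 2 (1 / 16) (1 / 50))
    (hT : TailDominationCert) (hU : UniformTameStability (1 / 50) 2)
    (hb : EquilChartGraphP 1 2 (1 / 16) (1 / 50)) (hl : GraphLevelsP 1 2 (1 / 16) (1 / 50))
    (hF : TailForceSlavingP 1 2 (1 / 16) (1 / 50))
    (hE' : LipDualLinearisationP 1 2 (1 / 16) (1 / 50)) (hA : L2HarmonicApproxP 1 2 (1 / 16) (1 / 50))
    (hD : PositionDecayPL 1 2 (1 / 16) (1 / 50)) (hC : PositionCaccioppoliPG 1 2 (1 / 16) (1 / 50))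
    (h1 : WildReRegistrationPG 1 2 (1 / 16) (1 / 50)) (hG : PeriodicBulkGapDoor 2) : VisibleGap (1 / 50) ∧ PertRegime (1 / 50) :=
  gap_and_pert_1_50_of_certs_16XH8 hL hL' hR hX hE hP hT hU hb hl hF hE' hA hD hC (wildFractionPG_of_wildReRegistrationPG h1) hG


end Summit.AtomisticToContinuum.Crystallization.Theorems.ChartedZeroExcessLayeredLatticeLiouville

end
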